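import Summits.Ventures.CertifiedManyBodySolver.Downfold.PhaseMapDistanceToPass

/-!
# The ROUTER code-word grammar of the phase-map schema, v1.8 vs v1.9 ITEM 17 (case-tolerant TAIL): the widening
# is monotone, the head initial is untouched, and what it does to a table's R tally

Kernel reference 25 of the material-oracle ACCEPTANCE test landed by hubbard-downfold-score-1 (second engine), in namespace
`Summit.Ventures.CertifiedManyBodySolver.Downfold.RouterGrammar` (+ three `CellScore.Tally` corollaries). Context
(2026-08-27): ROUTER.md v0.6.4 A6-ii prints the rare-earth head «UND:HF-candidate(RE-4f test: …)» and router.py r44 emitted it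
for M282 PrBa₂Cu₃O₇ (BOX OF RECORD #170); the code grammar of record (deputy-2 score.py `ROUTER_CODE_RE` = score-1 phasemap
`ROUTER_WORD_RE` = phase-map schema 402eea9f… `header.router.words[]` pattern) is
`^(EPH|1BH|3BE|BI|CI|SA|BILAYER-1BH|WEAK-COUPLING|UND:[A-Z0-9][A-Z0-9-]*)(\(.*\))?$`, whose UND tail admits no lower-case letter,
so the word is uncoded under v1.8 (R = ABSTAIN(uncoded); strict pre-flight W2:router — dag-2 HELD the hand-in, deputy-2 PEN
RULING G-1 SUPPLEMENT option (2), lead R-id). ACCEPTANCE v1.9 ITEM 17 (deputy-2 ISSUE KIT AMENDMENT 17:36Z + AMENDMENT-2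
19:38Z) widens ONLY the tail class to `[A-Za-z0-9-]` (schema rev-b 8b115c77…; score-1.9 `UND:[A-Z0-9][A-Za-z0-9-]*`), staged in
the second engine as flag `ROUTER_TAIL_ITEM17` (phasemap ≥ 1.8.72). What is proved here:

* §1 the grammar on code HEADS as a Boolean predicate (`coded tail w`; the parenthesised free text is dropped by both patterns
  and is not modelled): named heads are always coded; an `UND:<TAG>` word is coded iff TAG is non-empty, its first character is
  in `[A-Z0-9]` (`headChar`) and every later character is in the letter's tail class (`tail18` / `tail19`).
* §2 `coded19_of_coded18` — THE WIDENING IS MONOTONE: every word coded under v1.8 is coded under v1.9 (no word of record can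
  become uncoded at the flip; the acc1.8 «t» references keep their reading); `headChar_of_coded` — under EITHER letter a coded
  UND word starts with `[A-Z0-9]` (deputy-2 selftest S32: a lower-case HEAD initial stays uncoded).
* §3 instances by `decide`: the M282 tag `HF-candidate` is uncoded under v1.8 and coded under v1.9; `hf` is uncoded under both;
  `HF`, `MIXED`, `MULTIORB`, `STRUCT` (the upper-case tags the maps of record carry) are coded under both.
* §4 the R tally (ACCEPTANCE v1.3/§4.2: R = AGREE/(AGREE+PARTIAL+DISAGREE+ABSTAIN(uncoded)) — an uncoded word IS in the
  denominator): at the flip a word moves out of `uncoded` into a scored outcome with the denominator FIXED, so if `a` of them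
  become AGREE the tally is `convert a` and every met floor θ ≥ 0 stays met (`item17_flip_keeps_floor`); a HELD word (tonight's
  M282) is `pending` = outside the tally, and consuming it under v1.9 as AGREE is `addAgree 1`, which keeps every floor θ ≤ 1
  (`hold_then_agree_keeps_floor`); deputy-2's point (b) — a RE-CASED head would score PARTIAL against the curators' lower-case
  alternative, i.e. `addMiss 1`, which CAN flip a met floor (`recased_partial_flips_floor`: 9/10 meets 0.90, 9/11 does not);
  and the v8 numbers of record around RUN #72/#73 (`v8_item17_readings`: held 8/24 < v1.9 AGREE 9/25; the no-hold v1.8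
  reading 8/25 < 8/24).

WHAT THIS IS NOT: the scorer or schema of record (those are deputy-2's files and their score-1 mirror), a statement about
PrBa₂Cu₃O₇, or a ruling on the HF-candidate reading — only the kernel form of the grammar clause both engines implement and
of its bookkeeping consequences. Everything here is PROVED (no `sorry`, no new axioms).
-/

namespace Summit.Ventures.CertifiedManyBodySolver.Downfold

namespace RouterGrammar

/-! ## §1 The code-word grammar on heads -/

/-- The HEAD-INITIAL class of an `UND:<TAG>` tag under both letters: an upper-case ASCII letter or a digit (`[A-Z0-9]`).
[folklore] -/
def headChar (c : Char) : Bool := c.isUpper || c.isDigit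

/-- The v1.8 TAIL class `[A-Z0-9-]` (ACCEPTANCE v1.2–v1.8 code grammar of record). [folklore] -/
def tail18 (c : Char) : Bool := headChar c || c == '-'

/-- The v1.9 ITEM 17 TAIL class `[A-Za-z0-9-]` (case-tolerant tail; deputy-2 ISSUE KIT AMENDMENT 2026-08-27T17:36Z). [folklore] -/
def tail19 (c : Char) : Bool := tail18 c || c.isLower

/-- A router code word by its HEAD: the eight named heads of the grammar, or an `UND:` family word carrying its TAG (the
characters after `UND:` and before any `(`; the parenthesised free text is dropped by both patterns). [folklore] -/
inductive CodeWord
  | eph | bh1 | be3 | bi | ci | sa | bilayer1bh | weakCoupling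
  | und (tag : List Char)
  deriving DecidableEq, Repr

/-- A TAG is well-formed for a tail class: non-empty, head initial in `[A-Z0-9]`, every later character in the class.
[folklore] -/
def tagOK (tail : Char → Bool) : List Char → Bool
  | [] => false
  | c :: cs => headChar c && cs.all tail

/-- `coded tail w`: the word matches the code grammar whose UND tail class is `tail` (named heads always match). [folklore] -/
def coded (tail : Char → Bool) : CodeWord → Bool
  | .und tag => tagOK tail tag
  | _ => true

/-- coded under the v1.8 letter [folklore] -/
abbrev coded18 (w : CodeWord) : Bool := coded tail18 w

/-- coded under the v1.9 letter (item 17) [folklore] -/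
abbrev coded19 (w : CodeWord) : Bool := coded tail19 w

/-! ## §2 Monotonicity of the widening; the head initial is untouched -/

/-- Every v1.8 tail character is a v1.9 tail character. [folklore] -/
theorem tail19_of_tail18 {c : Char} (h : tail18 c = true) : tail19 c = true := by
  simp [tail19, h]

/-- `tagOK` is monotone in the tail class. [folklore] -/
theorem tagOK_mono {p q : Char → Bool} (hpq : ∀ c, p c = true → q c = true) :
    ∀ t : List Char, tagOK p t = true → tagOK q t = true
  | [], h => by simp [tagOK] at h
  | c :: cs, h => by
      simp only [tagOK, Bool.and_eq_true, List.all_eq_true] at h ⊢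
      exact ⟨h.1, fun x hx => hpq x (h.2 x hx)⟩

/-- `coded` is monotone in the tail class. [folklore] -/
theorem coded_mono {p q : Char → Bool} (hpq : ∀ c, p c = true → q c = true) (w : CodeWord)
    (h : coded p w = true) : coded q w = true := by
  cases w <;> simp_all [coded, tagOK_mono hpq]

/-- ITEM 17 IS A WIDENING: every word coded under v1.8 is coded under v1.9 — nothing of record becomes uncoded at the flip.
[folklore] -/
theorem coded19_of_coded18 (w : CodeWord) (h : coded18 w = true) : coded19 w = true :=
  coded_mono (fun _ hc => tail19_of_tail18 hc) w h

/-- Contrapositive reading used by the pens: a word uncoded under v1.9 was already uncoded under v1.8. [folklore] -/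
theorem uncoded18_of_uncoded19 (w : CodeWord) (h : coded19 w = false) : coded18 w = false := by
  cases h18 : coded18 w
  · rfl
  · rw [coded19_of_coded18 w h18] at h; exact absurd h (by decide)

/-- Under EITHER letter a coded UND word's tag starts in `[A-Z0-9]` (S32: a lower-case head initial stays uncoded).
[folklore] -/
theorem headChar_of_coded (tail : Char → Bool) {c : Char} {cs : List Char}
    (h : coded tail (.und (c :: cs)) = true) : headChar c = true := by
  simp only [coded, tagOK, Bool.and_eq_true] at h
  exact h.1

/-- … and an empty tag is never coded. [folklore] -/
theorem not_coded_nil (tail : Char → Bool) : coded tail (.und []) = false := rfl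

/-! ## §3 Instances: the tags on the buses tonight -/

/-- the M282 PrBa₂Cu₃O₇ tag `HF-candidate` (ROUTER.md A6-ii; BOX OF RECORD #170) [folklore] -/
def tagHFcandidate : List Char := ['H', 'F', '-', 'c', 'a', 'n', 'd', 'i', 'd', 'a', 't', 'e']

/-- M282's word is UNCODED under v1.8 (R = ABSTAIN(uncoded); strict pre-flight W2:router ⇒ dag-2's HOLD). [folklore] -/
theorem m282_uncoded_v18 : coded18 (.und tagHFcandidate) = false := by decide

/-- … and CODED under v1.9 item 17 (scored AGREE against the curators' «UND:HF-candidate+1BH+3BE»). [folklore] -/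
theorem m282_coded_v19 : coded19 (.und tagHFcandidate) = true := by decide

/-- A lower-case HEAD initial (`UND:hf…`) is uncoded under BOTH letters (deputy-2 selftest S32, vector i17-lower-case-head).
[folklore] -/
theorem lower_head_uncoded_both : coded18 (.und ['h', 'f']) = false ∧ coded19 (.und ['h', 'f']) = false := by decide

/-- The upper-case tags the maps of record carry (`HF`, `MIXED`, `MULTIORB`, `STRUCT`) are coded under both letters — the
flip changes no word already scored. [folklore] -/
theorem upper_tags_coded_both :
    (coded18 (.und ['H', 'F']) && coded19 (.und ['H', 'F']) &&
     coded18 (.und ['M', 'I', 'X', 'E', 'D']) && coded19 (.und ['M', 'I', 'X', 'E', 'D']) &&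
     coded18 (.und ['M', 'U', 'L', 'T', 'I', 'O', 'R', 'B']) && coded19 (.und ['M', 'U', 'L', 'T', 'I', 'O', 'R', 'B']) &&
     coded18 (.und ['S', 'T', 'R', 'U', 'C', 'T']) && coded19 (.und ['S', 'T', 'R', 'U', 'C', 'T'])) = true := by decide

/-- Named heads are coded under both letters (the widening touches the UND tail only). [folklore] -/
theorem named_coded_both (w : CodeWord) (h : ∀ t, w ≠ .und t) : coded18 w = true ∧ coded19 w = true := by
  cases w <;> simp_all [coded]

end RouterGrammar

/-! ## §4 What the flip does to a table's R tally (v1.3: an uncoded word is IN the denominator) -/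

namespace CellScore

namespace Tally

/-- ITEM 17 AT THE FLIP keeps every met R floor θ ≥ 0: the words that were uncoded sit in the denominator already; `a` of
them becoming AGREE (the rest PARTIAL/DISAGREE) is `convert a` — numerator + a, denominator unchanged. [folklore] -/
theorem item17_flip_keeps_floor (θ : ℚ) (hθ : 0 ≤ θ) (t : Tally) (a : ℕ) (h : meets θ t = true) :
    meets θ (t.convert a) = true :=
  meets_convert_mono θ hθ t 0 a (Nat.zero_le a) (by simpa [convert] using h)

/-- THE HOLD PATH (M282 tonight): a held hand-in is «pending» = outside the tally; consumed under v1.9 as AGREE it enters as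
`addAgree 1`, which keeps every met floor θ ≤ 1. [folklore] -/
theorem hold_then_agree_keeps_floor (θ : ℚ) (hθ1 : θ ≤ 1) (t : Tally) (h : meets θ t = true) :
    meets θ (t.addAgree 1) = true :=
  meets_addAgree_succ θ hθ1 t 0 (by simpa [addAgree] using h)

/-- deputy-2's point (b) against RE-CASING the head: a re-cased word validates but scores PARTIAL case-sensitively against
the curators' lower-case alternative, i.e. it enters as `addMiss 1` — and one more non-agreeing reading CAN flip a met floor:
R = 9/10 meets 0.90, 9/11 does not. [folklore] -/
theorem recased_partial_flips_floor :
    meets (9 / 10) ⟨9, 10⟩ = true ∧ meets (9 / 10) ((⟨9, 10⟩ : Tally).addMiss 1) = false := by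
  refine ⟨(meets_nine_tenths_iff 9 10).2 (by norm_num), ?_⟩
  rw [meets_eq_false_iff]; simp only [addMiss]; push_cast; norm_num

/-- The v8 readings of record around RUN #72/#73 (2026-08-27): with M282 HELD the v8 R tally read 8/24 (RUN #72) — consuming
the word under v1.9 as AGREE gives 9/25 > 8/24, while the no-hold v1.8 reading (uncoded, denominator only) would have been
8/25 < 8/24: the hold is the reading that neither inflates nor deflates R before the letter that codes the word. [folklore] -/
theorem v8_item17_readings :
    ratio ⟨8, 24⟩ < ratio ⟨9, 25⟩ ∧ ratio ⟨8, 25⟩ < ratio ⟨8, 24⟩ ∧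
    (⟨8, 24⟩ : Tally).addAgree 1 = ⟨9, 25⟩ ∧ (⟨8, 24⟩ : Tally).addMiss 1 = ⟨8, 25⟩ := by
  refine ⟨by norm_num [ratio], by norm_num [ratio], rfl, rfl⟩

end Tally

end CellScore

end Summit.Ventures.CertifiedManyBodySolver.Downfold
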